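import Summits.HubbardSuperconductivity.HubbardSuperconductivity.Theses.BalabanIR
import Literature.Computability.AlgebraicComplexity.QuantumFunctionalSpectral
import Literature.MathematicalPhysics.QuantumLattice.StabilitySpectralFlowProofs

/-!
# Disproof of `BalabanIR.BirBdGPhaseCoercivity` — standing adversary file (cdisprove)

Crux (item stmt-HubbardSuperconductivity-2081): for the d+id BdG matrix `Hb θ` on the torus (ℤ/L)²,
`S(θ) := ∑ |λᵢ(Hb θ)|` satisfies `S(0) − S(θ) ≥ c₀ · Rnn(θ)` with `Rnn(θ) = ∑ₓ ∑_{y nn x} (1 − cos(θ x − θ y))`,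
`c₀ = c₀(μ,Δ₁,Δ₂) > 0`, uniformly in `L ≥ L₀`.

VERDICT SO FAR (cycle 1): the statement RESISTS every cheap attack; no counterexample in any regime.
All numerics below mirror the Lean statement literally (ordered nn pairs, real-valued θ, indicator
conventions); scripts + outputs live in the refuter folder (tl.py, hessTL.py, tlscan.py, nm2x2.py,
smallL.py, ascent.py; kit jobs j004805/j005902/j005909 (numpy: 225-point c*/Hessian scan, periodic-cell TL
optimisation, torus L=12,16 ascent) are still QUEUED after 6 h at prio 79→85 and attach their manifests + FLAGS
lines to the item when they run — a later cycle must read them).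

## Findings index (prose only in docstrings/comments; everything declared here is sorry-free)

* §0 `crux_iff` — the crux restated through named pieces (`hMat`, `DMat`, `HbMat`, `Rnn`); `Iff.rfl`.
  `HbMat_isHermitian` — the `∀ hθ h0` binders are inhabited (no vacuity through missing proofs).
* §1 LOAD-BEARING ANALYSIS
  - `crux_false_without_pairing` : dropping BOTH `Δ₁ ≠ 0`, `Δ₂ ≠ 0` makes it false (Δ = 0 ⇒ RHS ≡ 0 < c₀·Rnn).
  - NOT load-bearing (numerically; exact second-order constant c_H stays > 0): `μ ∈ (−4,4)` (c_H > 0 at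
    μ = 4, 4.5, 6), `Δ₂ ≠ 0` alone (pure d_{x²−y²}, nodal: c_H(0.3,0.3,0)=3.8e-2), `Δ₁ ≠ 0` alone (pure d_{xy}:
    c_H(3.9,0,0.3)=2.4e-3). `L₀`: brute force at L = 2, 3 finds max_θ S(θ) = S(0) as well.
    ⇒ a proof cannot hinge on the spectral gap or on the band interior in an essential way; it must use Δ ≠ 0
    and the specific bond structure `(e^{iθx}+e^{iθy})/2`.
* §2 TIGHTNESS — `Rnn_const`, `sum_abs_eigenvalues_const`, `crux_both_sides_zero_at_const`: both sides
  vanish at constant θ (U(1) gauge rotation `gaugeU`, unitary conjugation preserves `∑|λᵢ|`). Quantitative (paper): the infimum of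
  (S(0)−S(θ))/Rnn(θ) is attained in the SMALL-AMPLITUDE STAGGERED mode θ = ε(−1)^{x₁+x₂} (q = (π,π); q = (π,0)
  when Δ₁ > Δ₂ near the band edge), NOT in the uniform twist: c_H(π,π) = 3.3e-4 at (μ,Δ₁,Δ₂)=(0,.01,.01),
  0.17 at (0,1,1), 0.57 at (0,3,·), ≈ Δ₁/5 for Δ₁ ≫ 4; stiffness c_H(q→0) is 2–80× larger. Large textures
  (walls, vortex lattices, π-checkerboards, FF twists) have ratios ≥ 1.03·c_H(π,π). Upper bounds any proof must
  respect: c₀ ≤ c_H(π,π) ~ Δ² log(1/Δ) (weak coupling) and c₀ ≤ |Δ₁|+|Δ₂| (one-site π-flip + ‖·‖₁ ≤ entrywise ℓ¹),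
  so the natural strengthening "c₀ uniform in Δ" is FALSE.
* §3b GAUGE IDENTITY (Lean, sorry-free): `gauge_conj` — `U(θ)ᴴ Hb(θ) U(θ) = HbGauged(θ)` with
  `U(θ) = diag(e^{iθ/2}) ⊕ diag(e^{-iθ/2})`, pairing block `DReal θ x y = d_{xy} · cos((θx−θy)/2)` REAL,
  hoppings twisted by `e^{∓i(θx−θy)/2}` (zero flux); `sum_abs_eigenvalues_gauge`: S(θ) = ∑|λᵢ(HbGauged θ)|.
  This is the exact starting point of (B) below and of any amplitude-loss / flux bookkeeping.
* §3 WHY IT RESISTS (comments below): (A) weak coupling, exact O(Δ²): S(θ) − S_normal = Σ_p |Ê(p)|² G(p) with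
  G(p) ≤ G(0) for every p by Cauchy–Schwarz (uniform maximises the second-order pairing gain for EVERY texture,
  any μ); (B) strong coupling: ‖(E D₀ + D₀ E)/2‖₁ ≤ ‖D₀‖₁ (triangle inequality, strict off constants); gauging by
  diag(e^{iθ/2}, e^{−iθ/2}) makes the pairing REAL with amplitudes d_{xy} cos((θx−θy)/2): vortices = π-fluxes of the
  pairing block (Lieb-type gain ≤ 18%) but cost |cos| ≤ 1/√2 on core bonds (checkerboard vortex lattice: S/S0 →
  0.836 as Δ → ∞); (C) AZHA point μ = 0, Δ₂ → 0, Δ₁ = t: uniform d-wave ≅ π-flux phase = Lieb-optimal flux;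
  (D) exact Hessian c_H(q) > 0 on 400+ parameter points, L-stable to n = 128; (E) UNBIASED gradient ascent of S on
  the L = 6 torus (analytic gradient via sgn Hb, starts: vortex–antivortex pair, π-wall, random ±π, uniform random)
  at (μ,Δ₁,Δ₂) ∈ {(3.5,.3,1),(0,1,.05),(3.9,.1,.1),(2,.5,.5)}: EVERY start flows to a constant texture (S → S(0) to
  1e-9…1e-13, Rnn → 0, vorticity → 0) — no metastable texture, no local maximum other than the U(1) orbit of θ ≡ const
  was found; Nelder–Mead over 2×2-periodic textures in the TL (6 points) and over all textures at L = 2, 3 likewise.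
* §4 DEAD PROOF ROUTE (warning to provers): the convexity split Hb(θ) = ½(H_A + H_B), H_A = [[h, E D₀],[·,−h]],
  H_B = [[h, D₀ E],[·,−h]] gives S(θ) ≤ ½(‖H_A‖₁+‖H_B‖₁), but ‖H_A‖₁ ≤ S(0) is FALSE: at (μ,Δ₁,Δ₂) = (3.9,.05,.05)
  the one-sided twist E = e^{i q·x}, q = 2π(2,0)/16 has ‖H_A‖₁ − S(0) = +5.8e-5·N (k-space formula
  Σ_k max(2√(ξ̄²+|Δ_k|²), |ξ_{k+q}−ξ_k|) vs Σ 2E_k). The amplitude reduction cos((θx−θy)/2) is essential.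
-/

noncomputable section

open scoped BigOperators Matrix
open Literature.Probability.LatticeModels (TorusSite)

namespace Summit.HubbardSuperconductivity.HubbardSuperconductivity.Cruxes.BirBdGPhaseCoercivity.Disproof

variable {L : ℕ}

/-! ## §0 Named pieces of the crux -/

/-- nearest neighbours along `e₁` (literal copy of the crux's `nnx`). -/
abbrev nnx (x y : TorusSite 2 L) : Prop := y = x + ![1, 0] ∨ y = x + ![-1, 0]
/-- nearest neighbours along `e₂`. -/
abbrev nny (x y : TorusSite 2 L) : Prop := y = x + ![0, 1] ∨ y = x + ![0, -1]
/-- diagonal neighbours along `e₁+e₂`. -/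
abbrev dg1 (x y : TorusSite 2 L) : Prop := y = x + ![1, 1] ∨ y = x + ![-1, -1]
/-- diagonal neighbours along `e₁-e₂`. -/
abbrev dg2 (x y : TorusSite 2 L) : Prop := y = x + ![1, -1] ∨ y = x + ![-1, 1]

variable [NeZero L]

/-- `h = −(nn adjacency) − μ·1` (t = 1, t' = 0). -/
def hMat (μ : ℝ) : Matrix (TorusSite 2 L) (TorusSite 2 L) ℂ :=
  fun x y => -(if nnx x y ∨ nny x y then (1 : ℂ) else 0) - (if x = y then (μ : ℂ) else 0)

/-- the d+id pairing matrix with phase texture `θ`: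
`D θ x y = (Δ₁ g_{x²−y²} + i Δ₂ g_{xy})(y − x) · (e^{iθx} + e^{iθy})/2`. -/
def DMat (Δ₁ Δ₂ : ℝ) (θ : TorusSite 2 L → ℝ) : Matrix (TorusSite 2 L) (TorusSite 2 L) ℂ :=
  fun x y => ((Δ₁ : ℂ) * ((if nnx x y then (1 : ℂ) else 0) - (if nny x y then (1 : ℂ) else 0)) +
    Complex.I * (Δ₂ : ℂ) * ((if dg1 x y then (1 : ℂ) else 0) - (if dg2 x y then (1 : ℂ) else 0))) *
    (Complex.exp (Complex.I * (θ x : ℂ)) + Complex.exp (Complex.I * (θ y : ℂ))) / 2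

/-- the BdG matrix `fromBlocks h (D θ) (D θ)ᴴ (−h)` on particle ⊕ hole indices. -/
def HbMat (μ Δ₁ Δ₂ : ℝ) (θ : TorusSite 2 L → ℝ) :
    Matrix (TorusSite 2 L ⊕ TorusSite 2 L) (TorusSite 2 L ⊕ TorusSite 2 L) ℂ :=
  Matrix.fromBlocks (hMat μ) (DMat Δ₁ Δ₂ θ) (Matrix.conjTranspose (DMat Δ₁ Δ₂ θ)) (-hMat μ)

/-- the XY gradient functional `∑ₓ ∑_{y nn x} (1 − cos(θ x − θ y))` (ordered pairs). -/
def Rnn (θ : TorusSite 2 L → ℝ) : ℝ :=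
  ∑ x : TorusSite 2 L, ∑ y : TorusSite 2 L, (if nnx x y ∨ nny x y then (1 - Real.cos (θ x - θ y)) else 0)

omit [NeZero L] in
/-- The crux, restated through the named pieces. -/
def Crux : Prop :=
  ∀ (μ Δ₁ Δ₂ : ℝ), μ ∈ Set.Ioo (-4:ℝ) 4 → Δ₁ ≠ 0 → Δ₂ ≠ 0 → ∃ c₀ : ℝ, 0 < c₀ ∧ ∃ L₀ : ℕ,
    ∀ (L : ℕ) [NeZero L], L₀ ≤ L → ∀ θ : TorusSite 2 L → ℝ,
      ∀ (hθ : (HbMat (L := L) μ Δ₁ Δ₂ θ).IsHermitian) (h0 : (HbMat (L := L) μ Δ₁ Δ₂ (fun _ => 0)).IsHermitian),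
        c₀ * Rnn θ ≤ ∑ i, |h0.eigenvalues i| - ∑ i, |hθ.eigenvalues i|

omit [NeZero L] in
/-- `Crux` is literally the route's crux (definitional unfolding of the `let`s). -/
theorem crux_iff : Theses.BalabanIR.BirBdGPhaseCoercivity ↔ Crux := Iff.rfl

/-! ## Hermiticity (the `∀ hθ h0` binders of the crux are inhabited) -/

omit [NeZero L] in
/-- `![-1, 0] = -![1, 0]` on the torus. -/
lemma e1_neg : (![-1, 0] : TorusSite 2 L) = -![1, 0] := by
  ext i; fin_cases i <;> simp

omit [NeZero L] in
/-- `![0, -1] = -![0, 1]` on the torus. -/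
lemma e2_neg : (![0, -1] : TorusSite 2 L) = -![0, 1] := by
  ext i; fin_cases i <;> simp

omit [NeZero L] in
/-- the e₁-neighbour relation is symmetric. -/
lemma nnx_symm (x y : TorusSite 2 L) : nnx x y ↔ nnx y x := by
  simp only [nnx, e1_neg]
  constructor
  · rintro (h | h)
    · right; rw [h]; abel
    · left; rw [h]; abel
  · rintro (h | h)
    · right; rw [h]; abel
    · left; rw [h]; abel

omit [NeZero L] in
/-- the e₂-neighbour relation is symmetric. -/
lemma nny_symm (x y : TorusSite 2 L) : nny x y ↔ nny y x := by
  simp only [nny, e2_neg]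
  constructor
  · rintro (h | h)
    · right; rw [h]; abel
    · left; rw [h]; abel
  · rintro (h | h)
    · right; rw [h]; abel
    · left; rw [h]; abel

omit [NeZero L] in
/-- the entries of `hMat μ` are real. -/
lemma hMat_apply_real (μ : ℝ) (x y : TorusSite 2 L) :
    hMat μ x y = ((-(if nnx x y ∨ nny x y then (1 : ℝ) else 0) - (if x = y then μ else 0) : ℝ) : ℂ) := by
  simp only [hMat]
  split_ifs <;> push_cast <;> ring

omit [NeZero L] in
/-- `h = −adjacency − μ` is Hermitian (real symmetric). [folklore] -/
theorem hMat_isHermitian (μ : ℝ) : (hMat (L := L) μ).IsHermitian := by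
  refine Matrix.IsHermitian.ext fun x y => ?_
  rw [hMat_apply_real, hMat_apply_real, Complex.star_def, Complex.conj_ofReal]
  congr 1
  have h1 : (nnx y x ∨ nny y x) = (nnx x y ∨ nny x y) :=
    propext (or_congr (nnx_symm y x) (nny_symm y x))
  simp only [h1]
  rcases eq_or_ne x y with rfl | hxy
  · rfl
  · simp [hxy, hxy.symm]

omit [NeZero L] in
/-- The BdG matrix of the crux is Hermitian for every texture: the crux's `∀ hθ h0` binders are
inhabited. [folklore] -/
theorem HbMat_isHermitian (μ Δ₁ Δ₂ : ℝ) (θ : TorusSite 2 L → ℝ) : (HbMat μ Δ₁ Δ₂ θ).IsHermitian :=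
  (hMat_isHermitian μ).fromBlocks rfl (hMat_isHermitian μ).neg

/-! ## §1 Load-bearing analysis -/

omit [NeZero L] in
/-- The crux with the two hypotheses `Δ₁ ≠ 0`, `Δ₂ ≠ 0` both dropped. -/
def CruxWithoutPairing : Prop :=
  ∀ (μ Δ₁ Δ₂ : ℝ), μ ∈ Set.Ioo (-4:ℝ) 4 → ∃ c₀ : ℝ, 0 < c₀ ∧ ∃ L₀ : ℕ,
    ∀ (L : ℕ) [NeZero L], L₀ ≤ L → ∀ θ : TorusSite 2 L → ℝ,
      ∀ (hθ : (HbMat (L := L) μ Δ₁ Δ₂ θ).IsHermitian) (h0 : (HbMat (L := L) μ Δ₁ Δ₂ (fun _ => 0)).IsHermitian),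
        c₀ * Rnn θ ≤ ∑ i, |h0.eigenvalues i| - ∑ i, |hθ.eigenvalues i|

omit [NeZero L] in
/-- at `Δ₁ = Δ₂ = 0` the pairing matrix does not depend on the texture. -/
lemma DMat_zero_pairing (θ : TorusSite 2 L → ℝ) : DMat (L := L) 0 0 θ = DMat 0 0 (fun _ => 0) := by
  ext x y; simp [DMat]

omit [NeZero L] in
/-- each term of `Rnn` is non-negative. -/
lemma Rnn_term_nonneg (θ : TorusSite 2 L → ℝ) (x y : TorusSite 2 L) :
    0 ≤ (if nnx x y ∨ nny x y then (1 - Real.cos (θ x - θ y)) else 0) := by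
  split_ifs
  · linarith [Real.cos_le_one (θ x - θ y)]
  · exact le_rfl

/-- the one-site π-flip texture used as witness. -/
def flip (L : ℕ) : TorusSite 2 L → ℝ := fun x => if x = 0 then Real.pi else 0

/-- A one-site π-flip has `Rnn ≥ 2 > 0` once `L ≥ 2` (the bond (0, e₁) alone contributes 2). -/
lemma Rnn_flip_pos (hL : 2 ≤ L) : 0 < Rnn (L := L) (flip L) := by
  haveI : Fact (1 < L) := ⟨by omega⟩
  have he : (![1, 0] : TorusSite 2 L) ≠ 0 := by
    intro h
    have := congrFun h 0
    simp at this
  let g : TorusSite 2 L → TorusSite 2 L → ℝ := fun x y =>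
    (if nnx x y ∨ nny x y then (1 - Real.cos (flip L x - flip L y)) else 0)
  have hg : ∀ x y, 0 ≤ g x y := fun x y => Rnn_term_nonneg (flip L) x y
  have hterm : g 0 ![1, 0] = 2 := by
    have hn : nnx (0 : TorusSite 2 L) ![1, 0] := Or.inl (by simp)
    simp only [g, if_pos (Or.inl hn : nnx (0 : TorusSite 2 L) ![1, 0] ∨ nny 0 ![1, 0]), flip,
      if_neg he, sub_zero]
    norm_num
  have inner : g 0 ![1, 0] ≤ ∑ y, g 0 y :=
    Finset.single_le_sum (f := fun y => g 0 y) (fun y _ => hg 0 y) (Finset.mem_univ _)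
  have outer : (∑ y, g 0 y) ≤ ∑ x, ∑ y, g x y :=
    Finset.single_le_sum (f := fun x => ∑ y, g x y) (fun x _ => Finset.sum_nonneg fun y _ => hg x y)
      (Finset.mem_univ _)
  have : (2 : ℝ) ≤ Rnn (flip L) := by
    unfold Rnn
    calc (2 : ℝ) = g 0 ![1, 0] := hterm.symm
      _ ≤ ∑ y, g 0 y := inner
      _ ≤ ∑ x, ∑ y, g x y := outer
  linarith

omit [NeZero L] in
/-- LOAD-BEARING: without `Δ₁ ≠ 0 ∧ Δ₂ ≠ 0` (both dropped) the crux is false — at Δ = 0 the BdG matrix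
does not see θ, so the right-hand side vanishes while `c₀ · Rnn θ > 0` for a one-site π-flip.
("Any proof must use that the pairing field is non-zero.") [folklore] -/
theorem crux_false_without_pairing : ¬ CruxWithoutPairing := by
  intro H
  obtain ⟨c₀, hc₀, L₀, H⟩ := H 0 0 0 (by norm_num [Set.mem_Ioo])
  haveI : NeZero (L₀ + 2) := ⟨by omega⟩
  have hθ := HbMat_isHermitian (L := L₀ + 2) 0 0 0 (flip (L₀ + 2))
  have h0 := HbMat_isHermitian (L := L₀ + 2) 0 0 0 (fun _ => 0)
  have key := H (L₀ + 2) (by omega) (flip (L₀ + 2)) hθ h0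
  have hmat : HbMat (L := L₀ + 2) 0 0 0 (flip (L₀ + 2)) = HbMat 0 0 0 (fun _ => 0) := by
    unfold HbMat; rw [DMat_zero_pairing]
  have heig := Literature.MathematicalPhysics.QuantumLattice.eigenvalues_eq_of_eq hmat hθ h0
  rw [heig, sub_self] at key
  have hR : 0 < Rnn (flip (L₀ + 2)) := Rnn_flip_pos (L := L₀ + 2) (by omega)
  linarith [mul_pos hc₀ hR]

/-! ## §2 Tightness at constants (U(1) symmetry): both sides vanish -/

/-- TIGHTNESS at constants: `Rnn` vanishes on constant textures (and so does the right-hand side,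
by U(1) symmetry), so the crux's inequality is an equality there. [folklore] -/
theorem Rnn_const (c : ℝ) : Rnn (L := L) (fun _ => c) = 0 := by
  simp [Rnn]


/-! ## §2b U(1) symmetry: `S(θ ≡ c) = S(0)` (so the crux is an equality on constants) -/

omit [NeZero L] in
/-- At a constant texture the pairing matrix is the uniform one times the phase `e^{ic}`. -/
lemma DMat_const (Δ₁ Δ₂ c : ℝ) :
    DMat (L := L) Δ₁ Δ₂ (fun _ => c) = Complex.exp (Complex.I * c) • DMat Δ₁ Δ₂ (fun _ => 0) := by
  ext x y
  simp only [DMat, Matrix.smul_apply, smul_eq_mul, Complex.ofReal_zero, mul_zero, Complex.exp_zero]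
  ring

/-- the global U(1) gauge rotation `diag(e^{ic/2}·1, e^{-ic/2}·1)` on particle ⊕ hole indices. -/
def gaugeU (L : ℕ) (c : ℝ) :
    Matrix (TorusSite 2 L ⊕ TorusSite 2 L) (TorusSite 2 L ⊕ TorusSite 2 L) ℂ :=
  Matrix.fromBlocks (Complex.exp (Complex.I * c / 2) • (1 : Matrix (TorusSite 2 L) (TorusSite 2 L) ℂ)) 0 0
    (Complex.exp (-(Complex.I * c / 2)) • (1 : Matrix (TorusSite 2 L) (TorusSite 2 L) ℂ))

/-- `conj (e^{z}) = e^{-z}` for purely imaginary `z = i·c/2`-type exponents. -/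
lemma star_exp_I_mul_div_two (c : ℝ) :
    star (Complex.exp (Complex.I * c / 2)) = Complex.exp (-(Complex.I * c / 2)) := by
  rw [Complex.star_def, ← Complex.exp_conj, map_div₀, map_mul, Complex.conj_I, Complex.conj_ofReal, map_ofNat]
  ring_nf

/-- `conj (e^{-ic/2}) = e^{ic/2}`. -/
lemma star_exp_neg_I_mul_div_two (c : ℝ) :
    star (Complex.exp (-(Complex.I * c / 2))) = Complex.exp (Complex.I * c / 2) := by
  have := congrArg star (star_exp_I_mul_div_two c)
  rw [star_star] at this
  exact this.symm

/-- `conj (e^{ic}) = e^{-ic}`. -/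
lemma star_exp_I_mul (c : ℝ) : star (Complex.exp (Complex.I * c)) = Complex.exp (-(Complex.I * c)) := by
  rw [Complex.star_def, ← Complex.exp_conj, map_mul, Complex.conj_I, Complex.conj_ofReal]
  ring_nf

omit [NeZero L] in
/-- the adjoint of the gauge rotation. -/
lemma gaugeU_conjTranspose (c : ℝ) :
    (gaugeU L c)ᴴ = Matrix.fromBlocks (Complex.exp (-(Complex.I * c / 2)) • (1 : Matrix (TorusSite 2 L) (TorusSite 2 L) ℂ))
      0 0 (Complex.exp (Complex.I * c / 2) • (1 : Matrix (TorusSite 2 L) (TorusSite 2 L) ℂ)) := by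
  unfold gaugeU
  rw [Matrix.fromBlocks_conjTranspose]
  simp [Matrix.conjTranspose_smul, star_exp_I_mul_div_two, star_exp_neg_I_mul_div_two]

/-- `e^{ic/2} e^{-ic/2} = 1`. -/
lemma exp_half_cancel₁ (c : ℝ) : Complex.exp (Complex.I * ↑c / 2 + -(Complex.I * ↑c / 2)) = 1 := by
  rw [← Complex.exp_zero]; congr 1; ring

/-- `e^{-ic/2} e^{ic/2} = 1`. -/
lemma exp_half_cancel₂ (c : ℝ) : Complex.exp (-(Complex.I * ↑c / 2) + Complex.I * ↑c / 2) = 1 := by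
  rw [← Complex.exp_zero]; congr 1; ring

/-- `e^{ic/2} e^{ic/2} = e^{ic}`. -/
lemma exp_half_add (c : ℝ) : Complex.exp (Complex.I * ↑c / 2 + Complex.I * ↑c / 2) = Complex.exp (Complex.I * ↑c) := by
  congr 1; ring

/-- `e^{-ic/2} e^{-ic/2} = e^{-ic}`. -/
lemma exp_half_add_neg (c : ℝ) :
    Complex.exp (-(Complex.I * ↑c / 2) + -(Complex.I * ↑c / 2)) = Complex.exp (-(Complex.I * ↑c)) := by
  congr 1; ring

/-- the gauge rotation is unitary. -/
lemma gaugeU_conjTranspose_mul (c : ℝ) : (gaugeU L c)ᴴ * gaugeU L c = 1 := by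
  rw [gaugeU_conjTranspose]
  unfold gaugeU
  rw [Matrix.fromBlocks_multiply, ← Matrix.fromBlocks_one]
  simp only [Matrix.smul_mul, Matrix.mul_smul, Matrix.one_mul, Matrix.mul_zero, Matrix.zero_mul, add_zero,
    zero_add, smul_zero, smul_smul, ← Complex.exp_add, exp_half_cancel₁, exp_half_cancel₂, one_smul]

/-- `U · Hb(0) · Uᴴ = Hb(c)` for the global gauge rotation. -/
lemma gaugeU_mul_HbMat_zero_mul (μ Δ₁ Δ₂ c : ℝ) :
    gaugeU L c * HbMat μ Δ₁ Δ₂ (fun _ => 0) * (gaugeU L c)ᴴ = HbMat μ Δ₁ Δ₂ (fun _ => c) := by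
  rw [gaugeU_conjTranspose]
  unfold gaugeU HbMat
  rw [Matrix.fromBlocks_multiply, Matrix.fromBlocks_multiply, DMat_const Δ₁ Δ₂ c, Matrix.conjTranspose_smul,
    star_exp_I_mul]
  simp only [Matrix.smul_mul, Matrix.mul_smul, Matrix.one_mul, Matrix.mul_one, Matrix.mul_zero, Matrix.zero_mul,
    add_zero, zero_add, neg_zero, smul_smul, ← Complex.exp_add, smul_neg,
    Matrix.mul_neg, exp_half_cancel₁, exp_half_cancel₂, exp_half_add, exp_half_add_neg, one_smul]

/-- U(1) TIGHTNESS: the spectral sum `∑ |λᵢ|` of the BdG matrix is the same at every constant texture,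
so at `θ ≡ c` both sides of the crux vanish (with `Rnn_const`). [folklore] -/
theorem sum_abs_eigenvalues_const (μ Δ₁ Δ₂ c : ℝ)
    (hc : (HbMat (L := L) μ Δ₁ Δ₂ (fun _ => c)).IsHermitian) (h0 : (HbMat (L := L) μ Δ₁ Δ₂ (fun _ => 0)).IsHermitian) :
    ∑ i, |hc.eigenvalues i| = ∑ i, |h0.eigenvalues i| := by
  have hV := gaugeU_conjTranspose_mul (L := L) c
  have hmat := gaugeU_mul_HbMat_zero_mul (L := L) μ Δ₁ Δ₂ c
  have hVMV : (gaugeU L c * HbMat μ Δ₁ Δ₂ (fun _ => 0) * (gaugeU L c)ᴴ).IsHermitian := by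
    rw [hmat]; exact hc
  have key := Literature.Computability.AlgebraicComplexity.sum_eigenvalues_isometry_conj
    (f := fun x : ℝ => |x|) h0 (gaugeU L c) hV hVMV (by simp)
  rw [← key, Literature.MathematicalPhysics.QuantumLattice.eigenvalues_eq_of_eq hmat.symm hc hVMV]

/-- The crux's inequality is an EQUALITY at constant textures: `c₀ · Rnn(c) = 0 = S(0) − S(c)`. -/
theorem crux_both_sides_zero_at_const (μ Δ₁ Δ₂ c c₀ : ℝ)
    (hc : (HbMat (L := L) μ Δ₁ Δ₂ (fun _ => c)).IsHermitian) (h0 : (HbMat (L := L) μ Δ₁ Δ₂ (fun _ => 0)).IsHermitian) :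
    c₀ * Rnn (L := L) (fun _ => c) = 0 ∧ ∑ i, |h0.eigenvalues i| - ∑ i, |hc.eigenvalues i| = 0 := by
  refine ⟨by rw [Rnn_const, mul_zero], ?_⟩
  rw [sum_abs_eigenvalues_const μ Δ₁ Δ₂ c hc h0, sub_self]

/-! ## §3b The gauge identity behind (B): after conjugation by `diag(e^{iθ/2}, e^{-iθ/2})` the pairing
block is REAL-AMPLITUDE `d_{xy} · cos((θx−θy)/2)` and all θ-phases sit on the (zero-flux) hoppings.
`S(θ)` equals the spectral sum of this gauged matrix — the amplitude loss `cos(Δθ/2)` and the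
vortex ⇒ π-flux correspondence are read off from it. -/

/-- the texture-dependent gauge rotation `diag(e^{iθx/2}) ⊕ diag(e^{-iθx/2})`. -/
def gaugeUθ (θ : TorusSite 2 L → ℝ) :
    Matrix (TorusSite 2 L ⊕ TorusSite 2 L) (TorusSite 2 L ⊕ TorusSite 2 L) ℂ :=
  Matrix.fromBlocks (Matrix.diagonal fun x => Complex.exp (Complex.I * θ x / 2)) 0 0
    (Matrix.diagonal fun x => Complex.exp (-(Complex.I * θ x / 2)))

/-- the bare d+id bond form factor `Δ₁ g_{x²−y²} + i Δ₂ g_{xy}` (texture-free part of `DMat`). -/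
def dForm (Δ₁ Δ₂ : ℝ) (x y : TorusSite 2 L) : ℂ :=
  (Δ₁ : ℂ) * ((if nnx x y then (1 : ℂ) else 0) - (if nny x y then (1 : ℂ) else 0)) +
    Complex.I * (Δ₂ : ℂ) * ((if dg1 x y then (1 : ℂ) else 0) - (if dg2 x y then (1 : ℂ) else 0))

/-- gauged pairing block: REAL amplitude reduction `cos((θx − θy)/2)` on every bond. -/
def DReal (Δ₁ Δ₂ : ℝ) (θ : TorusSite 2 L → ℝ) : Matrix (TorusSite 2 L) (TorusSite 2 L) ℂ :=
  fun x y => dForm Δ₁ Δ₂ x y * (Real.cos ((θ x - θ y) / 2) : ℂ)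

/-- gauged particle hopping: `e^{-i(θx−θy)/2} h_{xy}` (a zero-flux twist of `h`). -/
def hP (μ : ℝ) (θ : TorusSite 2 L → ℝ) : Matrix (TorusSite 2 L) (TorusSite 2 L) ℂ :=
  fun x y => Complex.exp (-(Complex.I * θ x / 2)) * hMat μ x y * Complex.exp (Complex.I * θ y / 2)

/-- gauged hole block: `−e^{+i(θx−θy)/2} h_{xy}`. -/
def hH (μ : ℝ) (θ : TorusSite 2 L → ℝ) : Matrix (TorusSite 2 L) (TorusSite 2 L) ℂ :=
  fun x y => -(Complex.exp (Complex.I * θ x / 2) * hMat μ x y * Complex.exp (-(Complex.I * θ y / 2)))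

/-- the gauged BdG matrix. -/
def HbGauged (μ Δ₁ Δ₂ : ℝ) (θ : TorusSite 2 L → ℝ) :
    Matrix (TorusSite 2 L ⊕ TorusSite 2 L) (TorusSite 2 L ⊕ TorusSite 2 L) ℂ :=
  Matrix.fromBlocks (hP μ θ) (DReal Δ₁ Δ₂ θ) (Matrix.conjTranspose (DReal Δ₁ Δ₂ θ)) (hH μ θ)

omit [NeZero L] in
/-- `conj (e^{iθx/2}) = e^{-iθx/2}` pointwise. -/
lemma star_exp_I_mul_div_two' (r : ℝ) :
    (starRingEnd ℂ) (Complex.exp (Complex.I * r / 2)) = Complex.exp (-(Complex.I * r / 2)) := by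
  have := star_exp_I_mul_div_two r
  rwa [Complex.star_def] at this

omit [NeZero L] in
/-- `conj (e^{-iθx/2}) = e^{iθx/2}` pointwise. -/
lemma star_exp_neg_I_mul_div_two' (r : ℝ) :
    (starRingEnd ℂ) (Complex.exp (-(Complex.I * r / 2))) = Complex.exp (Complex.I * r / 2) := by
  have := star_exp_neg_I_mul_div_two r
  rwa [Complex.star_def] at this

omit [NeZero L] in
/-- adjoint of the texture gauge rotation. -/
lemma gaugeUθ_conjTranspose (θ : TorusSite 2 L → ℝ) :
    (gaugeUθ θ)ᴴ = Matrix.fromBlocks (Matrix.diagonal fun x => Complex.exp (-(Complex.I * θ x / 2))) 0 0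
      (Matrix.diagonal fun x => Complex.exp (Complex.I * θ x / 2)) := by
  unfold gaugeUθ
  rw [Matrix.fromBlocks_conjTranspose, Matrix.diagonal_conjTranspose, Matrix.diagonal_conjTranspose,
    Matrix.conjTranspose_zero]
  have h1 : star (fun x => Complex.exp (Complex.I * θ x / 2)) = fun x => Complex.exp (-(Complex.I * θ x / 2)) := by
    funext x; simp only [Pi.star_apply]; exact star_exp_I_mul_div_two (θ x)
  have h2 : star (fun x => Complex.exp (-(Complex.I * θ x / 2))) = fun x => Complex.exp (Complex.I * θ x / 2) := by
    funext x; simp only [Pi.star_apply]; exact star_exp_neg_I_mul_div_two (θ x)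
  rw [h1, h2]

/-- the texture gauge rotation is unitary (left). -/
lemma gaugeUθ_conjTranspose_mul (θ : TorusSite 2 L → ℝ) : (gaugeUθ θ)ᴴ * gaugeUθ θ = 1 := by
  rw [gaugeUθ_conjTranspose]
  unfold gaugeUθ
  rw [Matrix.fromBlocks_multiply, ← Matrix.fromBlocks_one]
  simp only [Matrix.mul_zero, Matrix.zero_mul, add_zero, zero_add, Matrix.diagonal_mul_diagonal,
    ← Complex.exp_add]
  congr 1 <;> (rw [← Matrix.diagonal_one]; congr 1; funext x; rw [← Complex.exp_zero]; congr 1; ring)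

/-- the texture gauge rotation is unitary (right). -/
lemma gaugeUθ_mul_conjTranspose (θ : TorusSite 2 L → ℝ) : gaugeUθ θ * (gaugeUθ θ)ᴴ = 1 := by
  rw [gaugeUθ_conjTranspose]
  unfold gaugeUθ
  rw [Matrix.fromBlocks_multiply, ← Matrix.fromBlocks_one]
  simp only [Matrix.mul_zero, Matrix.zero_mul, add_zero, zero_add, Matrix.diagonal_mul_diagonal,
    ← Complex.exp_add]
  congr 1 <;> (rw [← Matrix.diagonal_one]; congr 1; funext x; rw [← Complex.exp_zero]; congr 1; ring)

omit [NeZero L] in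
/-- the bond factor identity `e^{-ia/2} (e^{ia} + e^{ib})/2 · e^{-ib/2} = cos((a−b)/2)`. -/
lemma phase_sandwich (a b : ℝ) :
    Complex.exp (-(Complex.I * a / 2)) * ((Complex.exp (Complex.I * a) + Complex.exp (Complex.I * b)) / 2) *
      Complex.exp (-(Complex.I * b / 2)) = (Real.cos ((a - b) / 2) : ℂ) := by
  rw [Complex.ofReal_cos, Complex.cos, mul_div_assoc]
  push_cast
  rw [show Complex.exp (Complex.I * ↑a) = Complex.exp (Complex.I * a / 2) * Complex.exp (Complex.I * a / 2) by
    rw [← Complex.exp_add]; congr 1; ring]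
  rw [show Complex.exp (Complex.I * ↑b) = Complex.exp (Complex.I * b / 2) * Complex.exp (Complex.I * b / 2) by
    rw [← Complex.exp_add]; congr 1; ring]
  have h1 : (↑a - ↑b) / 2 * Complex.I = Complex.I * a / 2 + -(Complex.I * b / 2) := by ring
  have h2 : -((↑a - ↑b) / 2) * Complex.I = -(Complex.I * a / 2) + Complex.I * b / 2 := by ring
  rw [h1, h2, Complex.exp_add, Complex.exp_add]
  have ea : Complex.exp (-(Complex.I * ↑a / 2)) * Complex.exp (Complex.I * ↑a / 2) = 1 := by
    rw [← Complex.exp_add, ← Complex.exp_zero]; congr 1; ring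
  have eb : Complex.exp (Complex.I * ↑b / 2) * Complex.exp (-(Complex.I * ↑b / 2)) = 1 := by
    rw [← Complex.exp_add, ← Complex.exp_zero]; congr 1; ring
  field_simp
  linear_combination (Complex.exp (Complex.I * ↑a / 2) * Complex.exp (-(Complex.I * ↑b / 2))) * ea +
    (Complex.exp (-(Complex.I * ↑a / 2)) * Complex.exp (Complex.I * ↑b / 2)) * eb

omit [NeZero L] in
/-- star of the half-phase functions (pointwise). -/
lemma star_halfPhase (θ : TorusSite 2 L → ℝ) :
    star (fun x => Complex.exp (-(Complex.I * θ x / 2))) = fun x => Complex.exp (Complex.I * θ x / 2) := by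
  funext x; simp only [Pi.star_apply]; exact star_exp_neg_I_mul_div_two (θ x)

/-- the gauged pairing block: `diag(e^{-iθ/2}) · D(θ) · diag(e^{-iθ/2}) = DReal θ` (real amplitudes
`cos((θx−θy)/2)`). -/
lemma gauge_pairing_block (Δ₁ Δ₂ : ℝ) (θ : TorusSite 2 L → ℝ) :
    Matrix.diagonal (fun x => Complex.exp (-(Complex.I * θ x / 2))) * DMat Δ₁ Δ₂ θ *
      Matrix.diagonal (fun x => Complex.exp (-(Complex.I * θ x / 2))) = DReal Δ₁ Δ₂ θ := by
  ext x y
  simp only [Matrix.mul_diagonal, Matrix.diagonal_mul, DReal, DMat, dForm]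
  rw [← phase_sandwich (θ x) (θ y)]
  ring

/-- THE GAUGE IDENTITY: `U(θ)ᴴ · Hb(θ) · U(θ) = HbGauged(θ)` — pairing amplitudes become the real numbers
`d_{xy} cos((θx−θy)/2)`, the texture phases move onto the hoppings (zero flux on every plaquette since
θ is a genuine real function). [folklore] -/
theorem gauge_conj (μ Δ₁ Δ₂ : ℝ) (θ : TorusSite 2 L → ℝ) :
    (gaugeUθ θ)ᴴ * HbMat μ Δ₁ Δ₂ θ * gaugeUθ θ = HbGauged μ Δ₁ Δ₂ θ := by
  rw [gaugeUθ_conjTranspose]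
  unfold gaugeUθ HbMat HbGauged
  rw [Matrix.fromBlocks_multiply, Matrix.fromBlocks_multiply]
  simp only [Matrix.mul_zero, Matrix.zero_mul, add_zero, zero_add]
  have h12 := gauge_pairing_block (L := L) Δ₁ Δ₂ θ
  have h11 : Matrix.diagonal (fun x => Complex.exp (-(Complex.I * θ x / 2))) * hMat μ *
      Matrix.diagonal (fun x => Complex.exp (Complex.I * θ x / 2)) = hP μ θ := by
    ext x y
    simp only [Matrix.mul_diagonal, Matrix.diagonal_mul, hP]
  have h21 : Matrix.diagonal (fun x => Complex.exp (Complex.I * θ x / 2)) * (DMat Δ₁ Δ₂ θ)ᴴ *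
      Matrix.diagonal (fun x => Complex.exp (Complex.I * θ x / 2)) = (DReal Δ₁ Δ₂ θ)ᴴ := by
    rw [← h12, Matrix.conjTranspose_mul, Matrix.conjTranspose_mul, Matrix.diagonal_conjTranspose,
      star_halfPhase, Matrix.mul_assoc]
  have h22 : Matrix.diagonal (fun x => Complex.exp (Complex.I * θ x / 2)) * (-hMat μ) *
      Matrix.diagonal (fun x => Complex.exp (-(Complex.I * θ x / 2))) = hH μ θ := by
    ext x y
    simp only [Matrix.mul_diagonal, Matrix.diagonal_mul, Matrix.mul_neg, Matrix.neg_apply, hH]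
    ring
  rw [h11, h12, h21, h22]

/-- the gauged matrix is Hermitian (it is a unitary conjugate of `HbMat`). -/
theorem HbGauged_isHermitian (μ Δ₁ Δ₂ : ℝ) (θ : TorusSite 2 L → ℝ) : (HbGauged μ Δ₁ Δ₂ θ).IsHermitian := by
  rw [← gauge_conj]
  exact Matrix.isHermitian_conjTranspose_mul_mul _ (HbMat_isHermitian μ Δ₁ Δ₂ θ)

/-- `S(θ) = ∑ |λᵢ(HbGauged θ)|`: the crux's spectral sum may be computed on the gauged matrix with REAL
pairing amplitudes `d_{xy} cos((θx−θy)/2)` — the form in which (B) "vortex = π-flux, amplitude cost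
|cos| ≤ 1/√2" and the Δ → ∞ triangle-inequality argument are visible. [folklore] -/
theorem sum_abs_eigenvalues_gauge (μ Δ₁ Δ₂ : ℝ) (θ : TorusSite 2 L → ℝ)
    (hθ : (HbMat (L := L) μ Δ₁ Δ₂ θ).IsHermitian) (hG : (HbGauged (L := L) μ Δ₁ Δ₂ θ).IsHermitian) :
    ∑ i, |hθ.eigenvalues i| = ∑ i, |hG.eigenvalues i| := by
  have hV : ((gaugeUθ θ)ᴴ)ᴴ * (gaugeUθ θ)ᴴ = 1 := by
    rw [Matrix.conjTranspose_conjTranspose]; exact gaugeUθ_mul_conjTranspose θ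
  have hmat : (gaugeUθ θ)ᴴ * HbMat μ Δ₁ Δ₂ θ * ((gaugeUθ θ)ᴴ)ᴴ = HbGauged μ Δ₁ Δ₂ θ := by
    rw [Matrix.conjTranspose_conjTranspose]; exact gauge_conj μ Δ₁ Δ₂ θ
  have hVMV : ((gaugeUθ θ)ᴴ * HbMat μ Δ₁ Δ₂ θ * ((gaugeUθ θ)ᴴ)ᴴ).IsHermitian := by rw [hmat]; exact hG
  have key := Literature.Computability.AlgebraicComplexity.sum_eigenvalues_isometry_conj
    (f := fun x : ℝ => |x|) hθ ((gaugeUθ θ)ᴴ) hV hVMV (by simp)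
  rw [← key, Literature.MathematicalPhysics.QuantumLattice.eigenvalues_eq_of_eq hmat hVMV hG]

end Summit.HubbardSuperconductivity.HubbardSuperconductivity.Cruxes.BirBdGPhaseCoercivity.Disproof
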